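import Summits.CriticalPhenomena.PercolationContinuityZ3.Theorems.PercNearOneGluingNoHeavyLowerTailSahiGridPatternDiagRouteTopCubeCert
import Summits.CriticalPhenomena.PercolationContinuityZ3.Theorems.PercNearOneGluingNoHeavyLowerTailSahiGridPatternDiagCertBlockAndRouting

/-!
# `NoHeavyLowerTail` (crux stmt-CriticalPhenomena-4575), Sahi programme P1: **TOP-CUBE × GOOD IS GOOD** —
# for every up-set `S` of a top cube `{1,2}^n ⊆ [3]^n` and every GOOD up-set `V ⊆ [3]^k` (no certificate), the block product `S × V`
# is a good first slot of the pattern functional: `0 ≤ sStarD (S × V) P Q` for ALL up-sets `P, Q ⊆ [3]^{n+k}` (every `n, k`)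

Support file (Sahi cell, seat `prim-sahi-p1`, generation 46; `--supports stmt-CriticalPhenomena-4575`).  Pure proofs, no definitions, no `sorry`,
standard axioms.  Vocabulary of `…SahiGridPattern{,CellForm,SliceForm,RectCert,DiagCertBlockAndT,DiagCertBlockAndRouting,DiagRouteTopCube}`
(`Pd`, `glue`, `freeOf`, `cellOf`, `sect`, `ind`, `thetaVal`, `lamU`, `sStarD`).

THE MATHEMATICS.  Call an up-set `V ⊆ [3]^k` GOOD if `sStarD V X X' ≥ 0` for all up-sets `X, X' ⊆ [3]^k`; equivalently (`…RectCert.sStarD_eq_sum_lamU_sub_sum_thetaVal`)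
the SIGNED diagonal vector `λ_V = 2^{k+1}1_V − ν_V` satisfies condition (N): `Θ_V(X×X') ≤ λ_V(X∩X')` (`thetaSum_le_lamU_of_good`); it satisfies (T) with
equality.  Generation 31's CONJECTURE D (`theta_blockAnd_le_diag_topCube`, proved for every `n, k`) says that for an up-set `S ⊆ [3]^n` with NO ZERO COORDINATE
the diagonal plan routes `Θ`:  `Θ_{S×V}(P×Q) ≤ 2^n Σ_{ξ∈S} Θ_V(P^ξ × Q^ξ)` — no certificate data.  The tree then derives (N) for `2^n·1_S ⊗ d` from (N) for a
certificate `d ≥ 0` of `V` (`diagCert_blockAnd_N_topCube`) and goodness of `[3]^m × (S × V)` (`sStarD_blockAnd_topCube_cylSet_nonneg'`), always assuming `d ≥ 0`.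
OBSERVATION OF THIS FILE: for the DIAGONAL plan the rectangle-domination step (H) of the routing lemma is an EQUALITY, so positivity of `d` is never used —
(N) transfers for every SIGNED `d` (`blockAnd_N_diag_topCube_signed`), in particular for `d = λ_V`, i.e. for a merely GOOD `V`; and (T) for `2^n·1_S ⊗ d` needs only
(T) for `d` (`…DiagCertBlockAndT.diagCert_blockAnd_T`, no sign hypothesis), trivially true for `λ_V`.  Hence:

  **THEOREM (`sStarD_blockAnd_topCube_nonneg_of_good`, every `n, k`).**  `S ⊆ [3]^n` an up-set with no zero coordinate, `V ⊆ [3]^k` a good up-set,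
  `A = S × V` ⟹ `0 ≤ sStarD A P Q` for all up-sets `P, Q ⊆ [3]^{n+k}`.

This is the statement `T×` ('good × good ⇒ good', the weakest all-`k` form of the seat's Conjecture A, memo gen43 §1.2) for EVERY top-cube outer block, with
the inner block only assumed good.  It is sharp as a statement about FORMAL proofs from black-box goodness: the generation-46 certificate LP (seat memo
FROM-prim-sahi-p1-gen46, code/gen46/certLP.py; section expansion + goodness/Harris/Kleitman/corner rows, general test pairs) is FEASIBLE for an outer block
`S ⊆ [3]²` exactly when `S` is one of the five non-empty top-square up-sets `↑22, ↑12, ↑21, ↑{12,21}, ↑11` (all covered here) and INFEASIBLE for the other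
fourteen (those meet the row or column `0`: they contain a cylinder direction or the corner cell, where the VALUE of a goodness slack is consumed — e.g.
`x∨y = ↑{01,10}`, even when `V` carries a genuine diagonal certificate).  The cylinder `[3]^m × (S×V)` is NOT claimed good here (for a merely good `V` that is
the open cylinder-closure question); with a certificate `d ≥ 0` of `V` it is `sStarD_blockAnd_topCube_cylSet_nonneg'`.
HONEST LABEL: `PatternPos d` (`d ≥ 5`), Conjecture A and `T×` for general outer blocks remain OPEN; nothing here asserts them. [this work]
-/

namespace Summit.CriticalPhenomena.PercolationContinuityZ3.Theorems.SahiGridPattern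

open Finset SahiGrid3
open scoped BigOperators

variable {n k : ℕ} {S : Finset (Pd n)} {V : Finset (Pd k)} {A : Finset (Pd (n + k))}

/-- **Goodness is condition (N) for the signed diagonal vector `λ_V`**: if `sStarD V X X' ≥ 0` for all up-sets `X, X'`, then
`Θ_V(X×X') ≤ λ_V(X∩X')` for all up-sets `X, X'`. [this work] -/
theorem thetaSum_le_lamU_of_good
    (hgood : ∀ X X' : Finset (Pd k), IsUpperSet (X : Set (Pd k)) → IsUpperSet (X' : Set (Pd k)) → 0 ≤ sStarD V X X')
    {X X' : Finset (Pd k)} (hX : IsUpperSet (X : Set (Pd k))) (hX' : IsUpperSet (X' : Set (Pd k))) :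
    (∑ q ∈ X, ∑ r ∈ X', thetaVal V q r) ≤ ∑ q ∈ X ∩ X', lamU V q := by
  have h := hgood X X' hX hX'
  rw [sStarD_eq_sum_lamU_sub_sum_thetaVal] at h
  linarith

/-- Conversely, (N) for `λ_V` gives goodness. [this work] -/
theorem good_of_thetaSum_le_lamU
    (hN : ∀ X X' : Finset (Pd k), IsUpperSet (X : Set (Pd k)) → IsUpperSet (X' : Set (Pd k)) →
      (∑ q ∈ X, ∑ r ∈ X', thetaVal V q r) ≤ ∑ q ∈ X ∩ X', lamU V q)
    {X X' : Finset (Pd k)} (hX : IsUpperSet (X : Set (Pd k))) (hX' : IsUpperSet (X' : Set (Pd k))) :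
    0 ≤ sStarD V X X' := by
  have h := hN X X' hX hX'
  rw [sStarD_eq_sum_lamU_sub_sum_thetaVal]
  linarith

/-- Bookkeeping for the diagonal plan: `Σ_ξ 2^n·1_S(ξ)·d(P^ξ ∩ Q^ξ) = Σ_{x ∈ P∩Q} 2^n·1_S(freeOf x)·d(cellOf x)` (any `d`, any finsets). [this work] -/
theorem sum_diag_sect_inter_eq_sum_dprime (S : Finset (Pd n)) (d : Pd k → ℤ) (P Q : Finset (Pd (n + k))) :
    (∑ ξ : Pd n, (2:ℤ) ^ n * ind S ξ * ∑ q ∈ sect P ξ ∩ sect Q ξ, d q) =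
      ∑ x ∈ P ∩ Q, (2:ℤ) ^ n * ind S (freeOf x) * d (cellOf x) := by
  rw [sum_mem_inter_dprime_eq d P Q]
  have e3 : ∀ ξ : Pd n, (2:ℤ) ^ n * ind S ξ * (∑ q ∈ sect P ξ ∩ sect Q ξ, d q) =
      ∑ q : Pd k, d q * ((2:ℤ) ^ n * (ind S ξ * ind P (glue ξ q) * ind Q (glue ξ q))) := by
    intro ξ
    rw [sum_mem_sect_inter_eq d P Q ξ ξ, Finset.mul_sum]
    refine Finset.sum_congr rfl fun q _ => ?_
    ring
  simp_rw [e3]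
  rw [Finset.sum_comm]
  refine Finset.sum_congr rfl fun q _ => ?_
  rw [← Finset.mul_sum, ← Finset.mul_sum]

/-- **(N) for the diagonal plan `2^n·1_S ⊗ d` from (N) for `(V, d)` — for every SIGNED `d`** (top-cube `S`; every `n, k`).  For the diagonal routing plan of
`…DiagRouteTopCube` the rectangle-domination step is an equality, so the sign hypothesis `d ≥ 0` of `diagCert_blockAnd_N_topCube` can be dropped:
`Θ_{S×V}(P×Q) ≤ Σ_{x∈P∩Q} 2^n·1_S(freeOf x)·d(cellOf x)` for all up-sets `P, Q`. [this work] -/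
theorem blockAnd_N_diag_topCube_signed (hS : IsUpperSet (S : Set (Pd n))) (htop : ∀ ξ ∈ S, ∀ a, ξ a ≠ 0)
    (hV : IsUpperSet (V : Set (Pd k))) (hA : ∀ ξ z, glue ξ z ∈ A ↔ (ξ ∈ S ∧ z ∈ V)) (d : Pd k → ℤ)
    (hN : ∀ X X' : Finset (Pd k), IsUpperSet (X : Set (Pd k)) → IsUpperSet (X' : Set (Pd k)) →
      (∑ q ∈ X, ∑ r ∈ X', thetaVal V q r) ≤ ∑ q ∈ X ∩ X', d q)
    {P Q : Finset (Pd (n + k))} (hP : IsUpperSet (P : Set (Pd (n + k)))) (hQ : IsUpperSet (Q : Set (Pd (n + k)))) :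
    (∑ x ∈ P, ∑ y ∈ Q, thetaVal A x y) ≤ ∑ x ∈ P ∩ Q, (2:ℤ) ^ n * ind S (freeOf x) * d (cellOf x) := by
  refine le_trans (theta_blockAnd_le_diag_topCube hS htop hV hA hP hQ) ?_
  -- collapse the diagonal plan
  have e1 : (∑ ξ : Pd n, ∑ η : Pd n, (if ξ = η then (2:ℤ) ^ n * ind S ξ else 0) *
        ∑ q ∈ sect P ξ, ∑ r ∈ sect Q η, thetaVal V q r) =
      ∑ ξ : Pd n, (2:ℤ) ^ n * ind S ξ * ∑ q ∈ sect P ξ, ∑ r ∈ sect Q ξ, thetaVal V q r := by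
    refine Finset.sum_congr rfl fun ξ _ => ?_
    rw [Finset.sum_eq_single ξ]
    · rw [if_pos rfl]
    · intro η _ hne
      rw [if_neg (Ne.symm hne), zero_mul]
    · intro h
      exact absurd (Finset.mem_univ ξ) h
  rw [e1]
  -- (N) on the diagonal section rectangles, weighted by `2^n·1_S(ξ) ≥ 0`
  have h2 : (∑ ξ : Pd n, (2:ℤ) ^ n * ind S ξ * ∑ q ∈ sect P ξ, ∑ r ∈ sect Q ξ, thetaVal V q r) ≤
      ∑ ξ : Pd n, (2:ℤ) ^ n * ind S ξ * ∑ q ∈ sect P ξ ∩ sect Q ξ, d q :=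
    Finset.sum_le_sum fun ξ _ => mul_le_mul_of_nonneg_left
      (hN _ _ (isUpperSet_sect hP ξ) (isUpperSet_sect hQ ξ)) (mul_nonneg (pow_nonneg (by norm_num) n) (ind_nonneg' S ξ))
  refine le_trans h2 (le_of_eq ?_)
  exact sum_diag_sect_inter_eq_sum_dprime S d P Q

/-- **THEOREM (TOP-CUBE × GOOD IS GOOD; every `n, k`).**  Let `S ⊆ [3]^n` be an up-set with no zero coordinate (an up-set of the top cube `{1,2}^n`),
`V ⊆ [3]^k` a GOOD up-set (`0 ≤ sStarD V X X'` for all up-sets `X, X'`), and `A = S × V` (`glue ξ z ∈ A ↔ ξ ∈ S ∧ z ∈ V`).  Then `A` is good: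
`0 ≤ sStarD A P Q` for all up-sets `P, Q ⊆ [3]^{n+k}`.  Proof: `sStarD A P Q = λ_A(P∩Q) − Θ_A(P×Q)`; `Θ_A(P×Q) ≤ (2^n·1_S ⊗ λ_V)(P∩Q)`
(`blockAnd_N_diag_topCube_signed` with `d = λ_V`, whose (N) is goodness of `V`) `≤ λ_A(P∩Q)` (`diagCert_blockAnd_T` with `d = λ_V`, whose (T) is an equality).
[this work] -/
theorem sStarD_blockAnd_topCube_nonneg_of_good (hS : IsUpperSet (S : Set (Pd n))) (htop : ∀ ξ ∈ S, ∀ a, ξ a ≠ 0)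
    (hV : IsUpperSet (V : Set (Pd k))) (hA : ∀ ξ z, glue ξ z ∈ A ↔ (ξ ∈ S ∧ z ∈ V))
    (hgood : ∀ X X' : Finset (Pd k), IsUpperSet (X : Set (Pd k)) → IsUpperSet (X' : Set (Pd k)) → 0 ≤ sStarD V X X')
    {P Q : Finset (Pd (n + k))} (hP : IsUpperSet (P : Set (Pd (n + k)))) (hQ : IsUpperSet (Q : Set (Pd (n + k)))) :
    0 ≤ sStarD A P Q := by
  rw [sStarD_eq_sum_lamU_sub_sum_thetaVal]
  have hN := blockAnd_N_diag_topCube_signed hS htop hV hA (lamU V)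
    (fun X X' hX hX' => thetaSum_le_lamU_of_good hgood hX hX') hP hQ
  have hPQ : IsUpperSet (((P ∩ Q : Finset (Pd (n + k))) : Set (Pd (n + k)))) := by
    rw [Finset.coe_inter]; exact hP.inter hQ
  have hT := diagCert_blockAnd_T hA hS (lamU V) (fun W _ => le_refl _) hPQ
  linarith

/-- **The same with the signed-certificate hypothesis made explicit** (every `n, k`): if some `d : [3]^k → ℤ` — of ANY sign — satisfies (N) `Θ_V(X×X') ≤ d(X∩X')`
and (T) `d(W) ≤ λ_V(W)` on up-sets, then `S × V` is good for every top-cube up-set `S`.  (For `d ≥ 0` this is the tree's BA₀(S); the point is that the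
diagonal plan never uses the sign.) [this work] -/
theorem sStarD_blockAnd_topCube_nonneg_of_signedCert (hS : IsUpperSet (S : Set (Pd n))) (htop : ∀ ξ ∈ S, ∀ a, ξ a ≠ 0)
    (hV : IsUpperSet (V : Set (Pd k))) (hA : ∀ ξ z, glue ξ z ∈ A ↔ (ξ ∈ S ∧ z ∈ V)) (d : Pd k → ℤ)
    (hT : ∀ W : Finset (Pd k), IsUpperSet (W : Set (Pd k)) → (∑ q ∈ W, d q) ≤ ∑ q ∈ W, lamU V q)
    (hN : ∀ X X' : Finset (Pd k), IsUpperSet (X : Set (Pd k)) → IsUpperSet (X' : Set (Pd k)) →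
      (∑ q ∈ X, ∑ r ∈ X', thetaVal V q r) ≤ ∑ q ∈ X ∩ X', d q)
    {P Q : Finset (Pd (n + k))} (hP : IsUpperSet (P : Set (Pd (n + k)))) (hQ : IsUpperSet (Q : Set (Pd (n + k)))) :
    0 ≤ sStarD A P Q := by
  rw [sStarD_eq_sum_lamU_sub_sum_thetaVal]
  have hN' := blockAnd_N_diag_topCube_signed hS htop hV hA d hN hP hQ
  have hPQ : IsUpperSet (((P ∩ Q : Finset (Pd (n + k))) : Set (Pd (n + k)))) := by
    rw [Finset.coe_inter]; exact hP.inter hQ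
  have hT' := diagCert_blockAnd_T hA hS d hT hPQ
  linarith

/-- **Iteration: nested top-cube blocks.**  For top-cube up-sets `S₁ ⊆ [3]^{n₁}`, `S₂ ⊆ [3]^{n₂}` and a good up-set `V ⊆ [3]^k`, the block product
`S₁ × (S₂ × V)` is good (every `n₁, n₂, k`). [this work] -/
theorem sStarD_blockAnd_topCube_twice_nonneg_of_good {n₁ n₂ : ℕ} {S₁ : Finset (Pd n₁)} {S₂ : Finset (Pd n₂)}
    {A₂ : Finset (Pd (n₂ + k))} {A₁ : Finset (Pd (n₁ + (n₂ + k)))}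
    (hS₁ : IsUpperSet (S₁ : Set (Pd n₁))) (htop₁ : ∀ ξ ∈ S₁, ∀ a, ξ a ≠ 0)
    (hS₂ : IsUpperSet (S₂ : Set (Pd n₂))) (htop₂ : ∀ ξ ∈ S₂, ∀ a, ξ a ≠ 0)
    (hV : IsUpperSet (V : Set (Pd k))) (hA₂ : ∀ ξ z, glue ξ z ∈ A₂ ↔ (ξ ∈ S₂ ∧ z ∈ V))
    (hA₁ : ∀ ξ x, glue ξ x ∈ A₁ ↔ (ξ ∈ S₁ ∧ x ∈ A₂))
    (hgood : ∀ X X' : Finset (Pd k), IsUpperSet (X : Set (Pd k)) → IsUpperSet (X' : Set (Pd k)) → 0 ≤ sStarD V X X')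
    {P Q : Finset (Pd (n₁ + (n₂ + k)))} (hP : IsUpperSet (P : Set (Pd (n₁ + (n₂ + k)))))
    (hQ : IsUpperSet (Q : Set (Pd (n₁ + (n₂ + k))))) : 0 ≤ sStarD A₁ P Q := by
  have hA₂up : IsUpperSet (A₂ : Set (Pd (n₂ + k))) := by
    intro x y hxy hx
    rw [Finset.mem_coe] at hx ⊢
    rw [← glue_freeOf_cellOf x, hA₂] at hx
    rw [← glue_freeOf_cellOf y, hA₂]
    exact ⟨hS₂ (fun a => hxy (Fin.castAdd k a)) hx.1, hV (fun a => hxy (Fin.natAdd n₂ a)) hx.2⟩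
  exact sStarD_blockAnd_topCube_nonneg_of_good hS₁ htop₁ hA₂up hA₁
    (fun X X' hX hX' => sStarD_blockAnd_topCube_nonneg_of_good hS₂ htop₂ hV hA₂ hgood hX hX') hP hQ

/-! ### Appendix (generation 46, later the same day): only the DIAGONAL section rectangles of `V` are used -/

/-- **(N) for the diagonal plan from LOCAL data** (every `n, k`; signed `d`): it suffices that `Θ_V(P^ξ×Q^ξ) ≤ d(P^ξ∩Q^ξ)` at the diagonal
section rectangles with `ξ ∈ S`. [this work] -/
theorem blockAnd_N_diag_topCube_signed_local (hS : IsUpperSet (S : Set (Pd n))) (htop : ∀ ξ ∈ S, ∀ a, ξ a ≠ 0)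
    (hV : IsUpperSet (V : Set (Pd k))) (hA : ∀ ξ z, glue ξ z ∈ A ↔ (ξ ∈ S ∧ z ∈ V)) (d : Pd k → ℤ)
    {P Q : Finset (Pd (n + k))} (hP : IsUpperSet (P : Set (Pd (n + k)))) (hQ : IsUpperSet (Q : Set (Pd (n + k))))
    (hNloc : ∀ ξ ∈ S, (∑ q ∈ sect P ξ, ∑ r ∈ sect Q ξ, thetaVal V q r) ≤ ∑ q ∈ sect P ξ ∩ sect Q ξ, d q) :
    (∑ x ∈ P, ∑ y ∈ Q, thetaVal A x y) ≤ ∑ x ∈ P ∩ Q, (2:ℤ) ^ n * ind S (freeOf x) * d (cellOf x) := by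
  refine le_trans (theta_blockAnd_le_diag_topCube hS htop hV hA hP hQ) ?_
  have e1 : (∑ ξ : Pd n, ∑ η : Pd n, (if ξ = η then (2:ℤ) ^ n * ind S ξ else 0) *
        ∑ q ∈ sect P ξ, ∑ r ∈ sect Q η, thetaVal V q r) =
      ∑ ξ : Pd n, (2:ℤ) ^ n * ind S ξ * ∑ q ∈ sect P ξ, ∑ r ∈ sect Q ξ, thetaVal V q r := by
    refine Finset.sum_congr rfl fun ξ _ => ?_
    rw [Finset.sum_eq_single ξ]
    · rw [if_pos rfl]
    · intro η _ hne
      rw [if_neg (Ne.symm hne), zero_mul]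
    · intro h
      exact absurd (Finset.mem_univ ξ) h
  rw [e1]
  have h2 : (∑ ξ : Pd n, (2:ℤ) ^ n * ind S ξ * ∑ q ∈ sect P ξ, ∑ r ∈ sect Q ξ, thetaVal V q r) ≤
      ∑ ξ : Pd n, (2:ℤ) ^ n * ind S ξ * ∑ q ∈ sect P ξ ∩ sect Q ξ, d q := by
    refine Finset.sum_le_sum fun ξ _ => ?_
    by_cases hξ : ξ ∈ S
    · exact mul_le_mul_of_nonneg_left (hNloc ξ hξ) (mul_nonneg (pow_nonneg (by norm_num) n) (ind_nonneg' S ξ))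
    · have h0 : ind S ξ = 0 := by unfold ind; rw [if_neg hξ]
      rw [h0, mul_zero, zero_mul, zero_mul]
  refine le_trans h2 (le_of_eq ?_)
  exact sum_diag_sect_inter_eq_sum_dprime S d P Q

/-- **TOP-CUBE × V IS GOOD AT `(P,Q)` AS SOON AS `V` IS GOOD AT THE DIAGONAL SECTION RECTANGLES** (every `n, k`): for an up-set `S ⊆ [3]^n` with no
zero coordinate, ANY up-set `V ⊆ [3]^k`, `A = S × V` and up-sets `P, Q ⊆ [3]^{n+k}`: if `0 ≤ sStarD V (P^ξ) (Q^ξ)` for every `ξ ∈ S`, then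
`0 ≤ sStarD A P Q`.  (The global theorem `sStarD_blockAnd_topCube_nonneg_of_good` is the case where `V` is good at every rectangle.) [this work] -/
theorem sStarD_blockAnd_topCube_nonneg_of_sectionGood (hS : IsUpperSet (S : Set (Pd n))) (htop : ∀ ξ ∈ S, ∀ a, ξ a ≠ 0)
    (hV : IsUpperSet (V : Set (Pd k))) (hA : ∀ ξ z, glue ξ z ∈ A ↔ (ξ ∈ S ∧ z ∈ V))
    {P Q : Finset (Pd (n + k))} (hP : IsUpperSet (P : Set (Pd (n + k)))) (hQ : IsUpperSet (Q : Set (Pd (n + k))))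
    (hloc : ∀ ξ ∈ S, 0 ≤ sStarD V (sect P ξ) (sect Q ξ)) :
    0 ≤ sStarD A P Q := by
  rw [sStarD_eq_sum_lamU_sub_sum_thetaVal]
  have hNloc : ∀ ξ ∈ S, (∑ q ∈ sect P ξ, ∑ r ∈ sect Q ξ, thetaVal V q r) ≤ ∑ q ∈ sect P ξ ∩ sect Q ξ, lamU V q := by
    intro ξ hξ
    have h := hloc ξ hξ
    rw [sStarD_eq_sum_lamU_sub_sum_thetaVal] at h
    linarith
  have hN := blockAnd_N_diag_topCube_signed_local hS htop hV hA (lamU V) hP hQ hNloc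
  have hPQ : IsUpperSet (((P ∩ Q : Finset (Pd (n + k))) : Set (Pd (n + k)))) := by
    rw [Finset.coe_inter]; exact hP.inter hQ
  have hT := diagCert_blockAnd_T hA hS (lamU V) (fun W _ => le_refl _) hPQ
  linarith

/-! ### Appendix 2 (generation 46): the quantitative lift behind the theorem -/

/-- **THE TOP-CUBE LIFT INEQUALITY (quantitative form; every `n, k`).**  For an up-set `S ⊆ [3]^n` with no zero coordinate, ANY up-set
`V ⊆ [3]^k`, `A = S × V` and all up-sets `P, Q ⊆ [3]^{n+k}`:
  `2^n · Σ_{ξ ∈ S} sStarD V (P^ξ) (Q^ξ) ≤ sStarD A P Q`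
(`P^ξ = sect P ξ` the sections).  For `n = 1`, `S = {2}` this is the top-only lift `2·S(V;B₂,C₂) ≤ S(A;B,C)` of `…TopOnlyTop`; for `S = {1,2}` it is a
DIAGONAL form `2·[S(V;B₁,C₁) + S(V;B₂,C₂)] ≤ S(A;B,C)` of the two-level lift; in general it is Conjecture D (`theta_blockAnd_le_diag_topCube`) plus the
transport step of `diagCert_blockAnd_T` applied to the signed vector `λ_V`.  No goodness of `V` is assumed; `sStarD_blockAnd_topCube_nonneg_of_good`
and `…_of_sectionGood` are immediate corollaries. [this work] -/
theorem two_pow_mul_sum_sStarD_sect_le_blockAnd_topCube (hS : IsUpperSet (S : Set (Pd n))) (htop : ∀ ξ ∈ S, ∀ a, ξ a ≠ 0)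
    (hV : IsUpperSet (V : Set (Pd k))) (hA : ∀ ξ z, glue ξ z ∈ A ↔ (ξ ∈ S ∧ z ∈ V))
    {P Q : Finset (Pd (n + k))} (hP : IsUpperSet (P : Set (Pd (n + k)))) (hQ : IsUpperSet (Q : Set (Pd (n + k)))) :
    (2:ℤ) ^ n * (∑ ξ ∈ S, sStarD V (sect P ξ) (sect Q ξ)) ≤ sStarD A P Q := by
  rw [sStarD_eq_sum_lamU_sub_sum_thetaVal A P Q]
  -- Conjecture D, with the diagonal plan collapsed
  have hΘ := theta_blockAnd_le_diag_topCube hS htop hV hA hP hQ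
  have e1 : (∑ ξ : Pd n, ∑ η : Pd n, (if ξ = η then (2:ℤ) ^ n * ind S ξ else 0) *
        ∑ q ∈ sect P ξ, ∑ r ∈ sect Q η, thetaVal V q r) =
      ∑ ξ : Pd n, (2:ℤ) ^ n * ind S ξ * ∑ q ∈ sect P ξ, ∑ r ∈ sect Q ξ, thetaVal V q r := by
    refine Finset.sum_congr rfl fun ξ _ => ?_
    rw [Finset.sum_eq_single ξ]
    · rw [if_pos rfl]
    · intro η _ hne
      rw [if_neg (Ne.symm hne), zero_mul]
    · intro h
      exact absurd (Finset.mem_univ ξ) h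
  rw [e1] at hΘ
  -- the transport step for the signed vector `λ_V`
  have hPQ : IsUpperSet (((P ∩ Q : Finset (Pd (n + k))) : Set (Pd (n + k)))) := by
    rw [Finset.coe_inter]; exact hP.inter hQ
  have hT := diagCert_blockAnd_T hA hS (lamU V) (fun W _ => le_refl _) hPQ
  rw [← sum_diag_sect_inter_eq_sum_dprime S (lamU V) P Q] at hT
  -- the left-hand side in the same shape
  have e2 : (2:ℤ) ^ n * (∑ ξ ∈ S, sStarD V (sect P ξ) (sect Q ξ)) =
      (∑ ξ : Pd n, (2:ℤ) ^ n * ind S ξ * ∑ q ∈ sect P ξ ∩ sect Q ξ, lamU V q) -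
        ∑ ξ : Pd n, (2:ℤ) ^ n * ind S ξ * ∑ q ∈ sect P ξ, ∑ r ∈ sect Q ξ, thetaVal V q r := by
    rw [sum_mem_eq_sum_ind_mul S, Finset.mul_sum, ← Finset.sum_sub_distrib]
    refine Finset.sum_congr rfl fun ξ _ => ?_
    rw [sStarD_eq_sum_lamU_sub_sum_thetaVal]
    ring
  rw [e2]
  linarith

end Summit.CriticalPhenomena.PercolationContinuityZ3.Theorems.SahiGridPattern
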